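import Summits.AnomalousDissipation.AnomalousDissipation.Theorems.QuarticTightness.Negative.Anatomy
import Literature.Analysis.FluidPDE.GalerkinFlow
import Literature.Analysis.FunctionSpaces.TorusHNegOnePairing

/-!
# Stub `stub_orbitLift` (S3) of the line `horizon-shooting` (payload `Ideate3Sketch`)
# for the crux `MomentParity.QuarticTightness` (stmt-AnomalousDissipation-14331)

Sorry-free discharge of the registered stub `stub_orbitLift` of the lead's skeleton: the forward
orbit `t ↦ Torus.galerkinFlow ν f N t a` of a Galerkin mode `a` of order `N` under the level-`N`
Galerkin semiflow of the Navier–Stokes equations on `T³` (smooth force `f`, `ν ≥ 0`), whose slices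
are mean-zero, lifts to a curve `U : ℝ → H`, `H = L²_σ(T³)`, continuous on `[0, ∞)`, whose value
at `t ≥ 0` is the `L²`-class of the slice and is carried by the punctured frequency ball
`0 < |k|² ≤ N²` (`QuarticGate.Negative.IsLevel N (U t)`).

**Proof.** On a Galerkin mode the slice at time `t` is the real trigonometric polynomial
`realTrigPoly (freqBall N) (coeffExt (freqBall N) (α t))` of the coefficient orbit
`α t := galerkinCoeffFlow ν (f̂|_{≤N}) t (â|_{≤N})` (`IsGalerkinMode.galerkinFlow_eq`), and `α` is
continuous on `[0, ∞)` (`isGalerkinODESolution_galerkinCoeffFlow`, `.continuousOn`). The synthesis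
map `Φ : c ↦ [realTrigPoly (freqBall N) c̄] ∈ L²(T³; ℝ³)` is additive with the bound
`‖Φ c‖₂ ≤ #(freqBall N) ‖c‖_∞` (pointwise `‖realTrigPoly S c̄ x‖ ≤ Σ_{k∈S} ‖c k‖`,
`Torus.norm_realTrigPoly_apply_le`, on the probability space `T³`), hence continuous
(`AddMonoidHomClass.continuous_of_bound`); so `U t := Φ (α (max t 0))` is continuous. Its values
lie in `H` because the slices are smooth, divergence free (`IsGalerkinMode.isGalerkinMode_galerkinFlow`)
and mean-zero (hypothesis), `Torus.smoothSolenoidal_subset_energySpace`. The level property: the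
Fourier coefficients only see the a.e. class (`QuarticGate.Negative.mFourierCoeff_congr_ae`); off
the ball they vanish by band-limitation (`IsGalerkinMode.mFourierCoeff_eq_zero`), and the zero
mode vanishes by the zero mean (`Torus.mFourierCoeff_complexify_zero_of_hasZeroMean`).

References: Constantin–Foias, *Navier–Stokes Equations* (Chicago 1988), Ch. 8, (8.3)–(8.6);
Robinson–Rodrigo–Sadowski, *The three-dimensional Navier–Stokes equations* (CUP 2016), §4.1,
Thm. 4.4 Step 1.
-/

open MeasureTheory Filter Topology Set
open scoped ENNReal InnerProductSpace RealInnerProductSpace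
open Literature.Analysis.FunctionSpaces Literature.Analysis.FluidPDE
open Summit.AnomalousDissipation.AnomalousDissipation.Theorems
open Summit.AnomalousDissipation.AnomalousDissipation.Theorems.QuarticGate.Negative
-- `T3 = UnitAddTorus (Fin 3)`, `R3 = EuclideanSpace ℝ (Fin 3)`, `H3 = ↥(Torus.energySpace (Fin 3))`, `L2T3 = ↥(Lp R3 2 volume)`
open Summit.AnomalousDissipation.AnomalousDissipation.Theorems.CubicParityLoud.Negative (T3 R3 H3 L2T3)
set_option linter.dupNamespace false
noncomputable section

namespace Summit.AnomalousDissipation.AnomalousDissipation.Theorems.MomentParityQuarticTightness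

/-- **The synthesis map is continuous.** On a finite frequency set `S ⊆ ℤ³`, the map sending a
coefficient vector `c : S → ℂ³` to the `L²(T³; ℝ³)`-class of the real trigonometric polynomial
`realTrigPoly S c̄` (`c̄ = coeffExt S c`) is continuous: it is additive and bounded by
`‖[realTrigPoly S c̄]‖₂ ≤ #S · ‖c‖_∞` (pointwise bound `Torus.norm_realTrigPoly_apply_le` on the
probability space `T³`). [folklore] -/
private theorem continuous_toLp_realTrigPoly (S : Finset (Fin 3 → ℤ)) :
    Continuous fun c : ↥S → EuclideanSpace ℂ (Fin 3) =>
      ((Torus.memLp_realTrigPoly S (Torus.coeffExt S c) 2).toLp _ : L2T3) := by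
  set Φ : (↥S → EuclideanSpace ℂ (Fin 3)) → L2T3 := fun c =>
    (Torus.memLp_realTrigPoly S (Torus.coeffExt S c) 2).toLp _ with hΦ
  -- additivity
  have hadd : ∀ c c', Φ (c + c') = Φ c + Φ c' := by
    intro c c'
    simp only [hΦ]
    rw [← MemLp.toLp_add]
    exact MemLp.toLp_congr _ _ (Eventually.of_forall fun x => by
      rw [Torus.coeffExt_add, Torus.realTrigPoly_add])
  -- the bound `‖Φ c‖ ≤ #S ‖c‖`
  have hbound : ∀ c, ‖Φ c‖ ≤ (S.card : ℝ) * ‖c‖ := by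
    intro c
    have h1 : ∀ᵐ x ∂(volume : Measure T3), ‖(Φ c : T3 → R3) x‖ ≤ (S.card : ℝ) * ‖c‖ := by
      filter_upwards [MemLp.coeFn_toLp (Torus.memLp_realTrigPoly S (Torus.coeffExt S c) 2)]
        with x hx
      rw [hΦ, hx]
      refine (Torus.norm_realTrigPoly_apply_le _ _ x).trans ?_
      calc ∑ k ∈ S, ‖Torus.coeffExt S c k‖ ≤ ∑ _k ∈ S, ‖c‖ :=
            Finset.sum_le_sum fun k _ => Torus.norm_coeffExt_le c k
        _ = (S.card : ℝ) * ‖c‖ := by rw [Finset.sum_const, nsmul_eq_mul]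
    have h2 := Lp.norm_le_of_ae_bound (by positivity) h1
    have hμ : measureUnivNNReal (volume : Measure T3) = 1 := by
      simp [measureUnivNNReal]
    rwa [hμ, NNReal.coe_one, Real.one_rpow, one_mul] at h2
  exact AddMonoidHomClass.continuous_of_bound (AddMonoidHom.mk' Φ hadd) _ hbound

/-- **S3 — THE ORBIT AS A CONTINUOUS `H`-VALUED CURVE OF LEVEL-`N` CLASSES.** For `ν ≥ 0`,
smooth `f`, a Galerkin mode `a` of order `N` whose orbit slices `Torus.galerkinFlow ν f N t a`
(`t ≥ 0`) are mean-zero, there is `U : ℝ → H` continuous on `[0, ∞)` with `U t` the `L²`-class of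
the slice (smooth, divergence-free, mean-zero slices are in `H`:
`Torus.smoothSolenoidal_subset_energySpace`) and `IsLevel N (U t)` (band-limitation of Galerkin
modes and zero mean; Fourier coefficients see only the a.e. class). Continuity: the slice is the
real trigonometric polynomial of the coefficient orbit `galerkinCoeffFlow ν (f̂|_{≤N}) t (â|_{≤N})`
(`IsGalerkinMode.galerkinFlow_eq`), which is continuous on `[0, ∞)`
(`isGalerkinODESolution_galerkinCoeffFlow`), composed with the continuous synthesis map
`c ↦ [realTrigPoly (freqBall N) c̄]`. Off `[0, ∞)` we take `U t = U 0`. [folklore;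
Constantin–Foias 1988, Ch. 8, (8.3)–(8.6); Robinson–Rodrigo–Sadowski 2016, §4.1] -/
theorem stub_orbitLift (ν : ℝ) (f : T3 → R3) (N : ℕ) (a : T3 → R3) (hν : 0 ≤ ν)
    (hf : Torus.IsSmooth f) (ha : IsGalerkinMode N a)
    (hmean : ∀ t, 0 ≤ t → Torus.HasZeroMean (Torus.galerkinFlow ν f N t a)) :
    ∃ U : ℝ → H3, ContinuousOn U (Ici 0) ∧ ∀ t, 0 ≤ t →
      IsLevel N (U t) ∧ ((U t).1 : T3 → R3) =ᵐ[volume] Torus.galerkinFlow ν f N t a := by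
  -- the coefficient orbit `α t = φ_t (â|_{≤N})` driven by `f̂|_{≤N}`
  set g : ↥(Torus.freqBall (d := Fin 3) N) → EuclideanSpace ℂ (Fin 3) :=
    fourierRestrict (Torus.freqBall N) f with hg
  set c₀ : ↥(Torus.freqBall (d := Fin 3) N) → EuclideanSpace ℂ (Fin 3) :=
    fourierRestrict (Torus.freqBall N) a with hc₀
  set α : ℝ → ↥(Torus.freqBall (d := Fin 3) N) → EuclideanSpace ℂ (Fin 3) :=
    fun s => galerkinCoeffFlow ν g s c₀ with hα
  have hsol : IsGalerkinODESolution ν g c₀ α :=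
    isGalerkinODESolution_galerkinCoeffFlow hν Torus.neg_mem_freqBall_of_mem
      (Torus.isRealCoeff_mFourierCoeff hf.integrable) ha.fourierRestrict_mem
  -- the synthesis map and the slices
  set Φ : (↥(Torus.freqBall (d := Fin 3) N) → EuclideanSpace ℂ (Fin 3)) → L2T3 := fun c =>
    (Torus.memLp_realTrigPoly (Torus.freqBall N) (Torus.coeffExt (Torus.freqBall N) c) 2).toLp _
    with hΦ
  have hΦc : Continuous Φ := continuous_toLp_realTrigPoly (Torus.freqBall N)
  have hslice : ∀ t, Torus.galerkinFlow ν f N t a =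
      Torus.realTrigPoly (Torus.freqBall N) (Torus.coeffExt (Torus.freqBall N) (α t)) :=
    fun t => ha.galerkinFlow_eq t
  have hae : ∀ t, ((Φ (α t) : L2T3) : T3 → R3) =ᵐ[volume] Torus.galerkinFlow ν f N t a := by
    intro t
    rw [hslice t, hΦ]
    exact MemLp.coeFn_toLp _
  have hGM : ∀ t, IsGalerkinMode N (Torus.galerkinFlow ν f N t a) :=
    fun t => ha.isGalerkinMode_galerkinFlow t
  -- the classes of the forward slices lie in `H`
  have hmem : ∀ t, 0 ≤ t → Φ (α t) ∈ Torus.energySpace (Fin 3) := fun t ht =>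
    Torus.smoothSolenoidal_subset_energySpace ⟨Torus.galerkinFlow ν f N t a, (hGM t).isSmooth,
      (hGM t).isDivFree, hmean t ht, hae t⟩
  refine ⟨fun t => ⟨Φ (α (max t 0)), hmem (max t 0) (le_max_right _ _)⟩, ?_, fun t ht => ?_⟩
  · -- continuity on `[0, ∞)` (indeed everywhere, through `max t 0`)
    refine Topology.IsInducing.subtypeVal.continuousOn_iff.2 (Continuous.continuousOn ?_)
    exact hΦc.comp (hsol.continuousOn.comp_continuous (continuous_id.max continuous_const)
      fun t => le_max_right t 0)
  · have ht0 : max t 0 = t := max_eq_left ht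
    refine ⟨fun k hk => ?_, ?_⟩
    · -- level `N`: coefficients of the class are those of the slice
      show UnitAddTorus.mFourierCoeff
        (EuclideanSpace.complexify ∘ ((Φ (α (max t 0)) : L2T3) : T3 → R3)) k = 0
      rw [ht0, mFourierCoeff_congr_ae (hae t)]
      by_cases hk0 : k = 0
      · subst hk0
        exact Torus.mFourierCoeff_complexify_zero_of_hasZeroMean (hGM t).isSmooth.integrable
          (hmean t ht)
      · have hkS : k ∉ Torus.freqBall N := fun h => hk (Finset.mem_erase.2 ⟨hk0, h⟩)
        exact (hGM t).mFourierCoeff_eq_zero (Torus.not_mem_freqBall.1 hkS)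
    · show ((Φ (α (max t 0)) : L2T3) : T3 → R3) =ᵐ[volume] Torus.galerkinFlow ν f N t a
      rw [ht0]
      exact hae t

end Summit.AnomalousDissipation.AnomalousDissipation.Theorems.MomentParityQuarticTightness

end
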